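import Literature.AnabelianGeometry.AbsoluteAnabelian.ZHatCompletionFreeProcyclic
import Mathlib.Topology.Instances.ZMod
import HarnessLib

/-!
# [AbsTopIII] Prop 1.4 (i) / Thm 1.11 (b): the cuspidal-data schemata `InertiaFreeProcyclic`,
# `DecompEqNormalizer` (FACT-LIST F-0406 / F-0405) — universal closures REFUTED, model instances WITNESSED

S. Mochizuki, *Topics in absolute anabelian geometry III*, J. Math. Sci. Univ. Tokyo 22 (2015)
[MochizukiAbsTopIII2015], Prop 1.4 (i) p. 31 ("the inertia group `I_x` of `x` in `Δ_U` is naturally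
isomorphic to `Ẑ(1)`") and Thm 1.11 (b) p. 46 ("the decomposition group `D_x` [...] may then be
constructed as the normalizer [...] of `I_x`"); manuscript pages (lit key `paper:url-5493eb38cbb7`).

PROOF-ONLY companion of `FundamentalExtension.lean` (abc-iut-L4-t1; no definition, no instance,
nothing restated), abc-iut cell seat abc-iut-f-095 (F fact-proving wave, tranche 95; FACT-LIST rows
**F-0406** `CuspidalData.InertiaFreeProcyclic`, **F-0405** `CuspidalData.DecompEqNormalizer`, class
`preparatory`, kernel_closedness `parametrised`).

Both rows are PARAMETRISED predicates over the interface data `E : FundamentalExtension`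
(`1 → Δ → Π → G → 1`, pure topological group theory) and `C : CuspidalData E` (CHOSEN subgroups
`D_x ⊆ Π`, `I_x = D_x ∩ Δ`); the typing does not — cannot, absent étale `π₁` — pin `E`, `C` to a
hyperbolic curve.  As for every schema row of the FACT-LIST (rule R5), the fully quantified closure
is NOT a theorem, while the predicate is satisfiable at its intended model:

* `not_isFreeProcyclic_of_subsingleton` — the trivial group is not "`≅ Ẑ`" (it has no open subgroup
  of index `2`); hence `CuspidalData.not_inertiaFreeProcyclic_of_Icusp_eq_bot` and the refutation
  `CuspidalData.not_forall_inertiaFreeProcyclic` (at `Π = G = 1`, one cusp with `D_x = Π`);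
* `CuspidalData.dcusp_ne_normalizer_of_eq_bot` — in a nontrivial `Π` a cusp with `D_x = 1` violates
  "`D_x = N_Π(I_x)`"; hence `CuspidalData.not_forall_decompEqNormalizer` (at `Π = ℤ/2`, `G = 1`);
* positively: both predicates hold vacuously without cusps (`…_of_isEmpty`), `D_x = N_Π(I_x)` holds
  at any cusp with `D_x = Π` (`dcusp_eq_normalizer_of_eq_top`, since `I_x = Δ` is normal), and
  `CuspidalData.exists_inertiaFreeProcyclic_decompEqNormalizer` exhibits ONE extension with a cusp
  at which BOTH rows hold: `Π = Ẑ` (Mathlib's profinite completion of `ℤ`, free procyclic by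
  `isFreeProcyclic_zHatCompletion`), `G = 1`, `D_x = Π`, `I_x = D_x ∩ Δ = Ẑ`.

So each row is admissible ONLY in instance form (FACT-LIST class «universal-closure REFUTED;
instance model-witnessed»); the instance the cone binds is the model-relative named fact
`AbsTopIII.CurveModel.Prop_1_4_i` (F-0339), untouched here.  Classical profinite group theory;
nothing in this file bears on the disputed [IUTchIII] Cor. 3.12 or takes a side; refuted is never a
fact; typed ≠ proved elsewhere.
-/

noncomputable section

open CategoryTheory Topology

namespace Literature.AnabelianGeometry.AbsoluteAnabelian

namespace FundamentalExtension

universe u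

/-! ### Structural lemmas (every universe) -/

/-- The trivial topological group is NOT free procyclic ("`≅ Ẑ`", [AbsTopI] §0 p. 7): it has no
subgroup of index `2`. [cite: MochizukiAbsTopIII2015, Prop 1.4 (i) p.31] -/
theorem not_isFreeProcyclic_of_subsingleton {G : Type u} [Group G] [TopologicalSpace G]
    [Subsingleton G] : ¬ IsFreeProcyclic G := by
  intro h
  obtain ⟨H, -, hH⟩ := h.exists_isOpen_index 2 two_pos
  have htop : H = ⊤ := eq_top_iff.2 fun g _ => by
    rw [Subsingleton.elim g 1]
    exact H.one_mem
  rw [htop, Subgroup.index_top] at hH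
  exact absurd hH (by decide)

variable {E : FundamentalExtension.{u}} (C : CuspidalData E)

/-- Without cusps, "every `I_x ≅ Ẑ`" holds vacuously. [cite: MochizukiAbsTopIII2015, Prop 1.4 (i) p.31] -/
theorem CuspidalData.inertiaFreeProcyclic_of_isEmpty [IsEmpty C.Cusp] : C.InertiaFreeProcyclic :=
  fun x => isEmptyElim x

/-- Without cusps, "every `D_x = N_Π(I_x)`" holds vacuously.
[cite: MochizukiAbsTopIII2015, Thm 1.11 (b) p.46] -/
theorem CuspidalData.decompEqNormalizer_of_isEmpty [IsEmpty C.Cusp] : C.DecompEqNormalizer :=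
  fun x => isEmptyElim x

/-- A cusp whose chosen inertia group is trivial violates "`I_x ≅ Ẑ`": the schema
`InertiaFreeProcyclic` is a genuine constraint on the data `C`, not a theorem about it.
[cite: MochizukiAbsTopIII2015, Prop 1.4 (i) p.31] -/
theorem CuspidalData.not_inertiaFreeProcyclic_of_Icusp_eq_bot {x : C.Cusp} (hx : C.Icusp x = ⊥) :
    ¬ C.InertiaFreeProcyclic := by
  intro h
  haveI : Subsingleton (C.Icusp x) :=
    ⟨fun a b => Subtype.ext ((Subgroup.mem_bot.1 (hx ▸ a.2 : (a : E.arith) ∈ (⊥ : Subgroup E.arith))).trans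
      (Subgroup.mem_bot.1 (hx ▸ b.2 : (b : E.arith) ∈ (⊥ : Subgroup E.arith))).symm)⟩
  exact not_isFreeProcyclic_of_subsingleton (h x)

/-- At a cusp with `D_x = Π` one has `I_x = D_x ∩ Δ = Δ`, normal in `Π`, so `N_Π(I_x) = Π = D_x`:
the clause "`D_x` is the normalizer of `I_x`" HOLDS at such a cusp.
[cite: MochizukiAbsTopIII2015, Thm 1.11 (b) p.46] -/
theorem CuspidalData.dcusp_eq_normalizer_of_eq_top {x : C.Cusp} (hx : C.Dcusp x = ⊤) :
    C.Dcusp x = Subgroup.normalizer (C.Icusp x : Set E.arith) := by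
  have hI : C.Icusp x = E.geom := by rw [C.Icusp_eq, hx, top_inf_eq]
  rw [hx, hI]
  exact (Subgroup.normalizer_eq_top (H := E.geom)).symm

/-- At a cusp with `D_x = 1` in a nontrivial `Π` one has `I_x = 1` and `N_Π(I_x) = Π ≠ D_x`: the
schema `DecompEqNormalizer` is a genuine constraint on the data `C`, not a theorem about it.
[cite: MochizukiAbsTopIII2015, Thm 1.11 (b) p.46] -/
theorem CuspidalData.dcusp_ne_normalizer_of_eq_bot [Nontrivial E.arith] {x : C.Cusp}
    (hx : C.Dcusp x = ⊥) : C.Dcusp x ≠ Subgroup.normalizer (C.Icusp x : Set E.arith) := by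
  have hI : C.Icusp x = ⊥ := by rw [C.Icusp_eq, hx, bot_inf_eq]
  rw [hx, hI, Subgroup.normalizer_eq_top]
  exact bot_ne_top

/-- Hence `DecompEqNormalizer` FAILS for any cuspidal data with a cusp of trivial decomposition
group in a nontrivial `Π`. [cite: MochizukiAbsTopIII2015, Thm 1.11 (b) p.46] -/
theorem CuspidalData.not_decompEqNormalizer_of_Dcusp_eq_bot [Nontrivial E.arith] {x : C.Cusp}
    (hx : C.Dcusp x = ⊥) : ¬ C.DecompEqNormalizer :=
  fun h => C.dcusp_ne_normalizer_of_eq_bot hx (h x)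

/-! ### F-0406: the universal closure of `InertiaFreeProcyclic` is false -/

/-- **F-0406, universal closure REFUTED.**  Over the trivial extension `Π = G = 1` the cuspidal
data with one cusp, `D_x = Π`, `I_x = D_x ∩ Δ = 1` is NOT `InertiaFreeProcyclic`; so
"`∀ E C, C.InertiaFreeProcyclic`" is not a theorem — the row is an assumption on `C` (instance
form: `AbsTopIII.CurveModel.Prop_1_4_i`). [cite: MochizukiAbsTopIII2015, Prop 1.4 (i) p.31] -/
theorem CuspidalData.not_forall_inertiaFreeProcyclic :
    ¬ ∀ (E : FundamentalExtension.{0}) (C : CuspidalData E),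
        Literature.AnabelianGeometry.AbsoluteAnabelian.FundamentalExtension.CuspidalData.InertiaFreeProcyclic C := by
  intro h
  let T : Type := Multiplicative (ZMod 1)
  haveI hT : Subsingleton T := inferInstanceAs (Subsingleton (Multiplicative (Fin 1)))
  let E : FundamentalExtension.{0} :=
    { arith := ProfiniteGrp.of T, gal := ProfiniteGrp.of T, aug := ContinuousMonoidHom.id T,
      aug_surjective := Function.surjective_id }
  haveI hE : Subsingleton E.arith := hT
  let C : CuspidalData E :=
    { Cusp := PUnit
      Dcusp := fun _ => ⊤
      Icusp := fun _ => ⊤ ⊓ E.geom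
      Icusp_eq := fun _ => rfl
      isClosed_Dcusp := fun _ => isClosed_discrete _
      eq_of_conj := fun _ _ _ _ => rfl }
  exact not_isFreeProcyclic_of_subsingleton (h E C PUnit.unit)

/-! ### F-0405: the universal closure of `DecompEqNormalizer` is false -/

/-- **F-0405, universal closure REFUTED.**  Over `Π = ℤ/2 ↠ G = 1` the cuspidal data with one
cusp and `D_x = 1` has `I_x = 1`, `N_Π(I_x) = Π ≠ D_x`; so "`∀ E C, C.DecompEqNormalizer`" is not a
theorem — the row is an assumption on `C`. [cite: MochizukiAbsTopIII2015, Thm 1.11 (b) p.46] -/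
theorem CuspidalData.not_forall_decompEqNormalizer :
    ¬ ∀ (E : FundamentalExtension.{0}) (C : CuspidalData E),
        Literature.AnabelianGeometry.AbsoluteAnabelian.FundamentalExtension.CuspidalData.DecompEqNormalizer C := by
  intro h
  let M : Type := Multiplicative (ZMod 2)
  let T : Type := Multiplicative (ZMod 1)
  haveI hT : Subsingleton T := inferInstanceAs (Subsingleton (Multiplicative (Fin 1)))
  let E : FundamentalExtension.{0} :=
    { arith := ProfiniteGrp.of M, gal := ProfiniteGrp.of T, aug := 1,
      aug_surjective := fun t => ⟨1, Subsingleton.elim _ _⟩ }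
  have hM : Nontrivial (Multiplicative (ZMod 2)) :=
    ⟨⟨Multiplicative.ofAdd 0, Multiplicative.ofAdd 1, by decide⟩⟩
  haveI hM' : Nontrivial E.arith := hM
  let C : CuspidalData E :=
    { Cusp := PUnit
      Dcusp := fun _ => ⊥
      Icusp := fun _ => ⊥ ⊓ E.geom
      Icusp_eq := fun _ => rfl
      isClosed_Dcusp := fun _ => isClosed_discrete _
      eq_of_conj := fun _ _ _ _ => rfl }
  exact C.not_decompEqNormalizer_of_Dcusp_eq_bot (x := PUnit.unit) rfl (h E C)

/-! ### The intended model: one cusp with `I_x = Ẑ` satisfies BOTH rows -/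

/-- **F-0406 / F-0405, model WITNESS.**  The extension `Π = Ẑ` (Mathlib's profinite completion of
`ℤ`) `↠ G = 1` with one cusp, `D_x = Π`, `I_x = D_x ∩ Δ = Ẑ`, satisfies `InertiaFreeProcyclic`
("`I_x ≅ Ẑ`", by `isFreeProcyclic_zHatCompletion`) AND `DecompEqNormalizer` (`I_x = Δ` is normal):
both schemata are satisfiable with a cusp present, as at the cusps of a hyperbolic curve.
[cite: MochizukiAbsTopIII2015, Prop 1.4 (i) p.31] -/
theorem CuspidalData.exists_inertiaFreeProcyclic_decompEqNormalizer :
    ∃ (E : FundamentalExtension.{0}) (C : CuspidalData E), Nonempty C.Cusp ∧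
      Literature.AnabelianGeometry.AbsoluteAnabelian.FundamentalExtension.CuspidalData.InertiaFreeProcyclic C ∧
      Literature.AnabelianGeometry.AbsoluteAnabelian.FundamentalExtension.CuspidalData.DecompEqNormalizer C := by
  let T : Type := Multiplicative (ZMod 1)
  haveI hT : Subsingleton T := inferInstanceAs (Subsingleton (Multiplicative (Fin 1)))
  let Z : ProfiniteGrp.{0} :=
    ProfiniteGrp.ProfiniteCompletion.completion (GrpCat.of (Multiplicative ℤ))
  let E : FundamentalExtension.{0} :=
    { arith := Z, gal := ProfiniteGrp.of T, aug := 1,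
      aug_surjective := fun t => ⟨1, Subsingleton.elim _ _⟩ }
  let C : CuspidalData E :=
    { Cusp := PUnit
      Dcusp := fun _ => ⊤
      Icusp := fun _ => ⊤ ⊓ E.geom
      Icusp_eq := fun _ => rfl
      isClosed_Dcusp := fun _ => by
        rw [Subgroup.coe_top]
        exact isClosed_univ
      eq_of_conj := fun _ _ _ _ => rfl }
  have hgeom : E.geom = ⊤ := eq_top_iff.2 fun g _ => E.mem_geom.2 (Subsingleton.elim _ _)
  have hI : ∀ x, C.Icusp x = ⊤ := fun x => by
    change ⊤ ⊓ E.geom = ⊤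
    rw [hgeom, top_inf_eq]
  refine ⟨E, C, ⟨PUnit.unit⟩, fun x => ?_, fun x => C.dcusp_eq_normalizer_of_eq_top rfl⟩
  have hz : ∀ z : (Z : Type), z ∈ C.Icusp x := fun z => by
    rw [hI x]
    exact Subgroup.mem_top z
  have e : (Z : Type) ≃ₜ* (C.Icusp x) :=
    { toFun := fun z => ⟨z, hz z⟩
      invFun := fun g => g.1
      left_inv := fun _ => rfl
      right_inv := fun _ => rfl
      map_mul' := fun _ _ => rfl
      continuous_toFun := continuous_id.subtype_mk hz
      continuous_invFun := continuous_subtype_val }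
  exact isFreeProcyclic_zHatCompletion.of_continuousMulEquiv e

/-! ### F-2464: the universal closure of `IsFreeProcyclic` is false -/

/-- **F-2464, universal closure REFUTED.**  "`∀ G, IsFreeProcyclic G`" is not a theorem: the trivial
group is not free procyclic (`not_isFreeProcyclic_of_subsingleton`); the predicate "`≅ Ẑ`" is an
assumption on a given group, satisfied by `Ẑ` itself (`isFreeProcyclic_zHatCompletion`,
`isFreeProcyclic_padicProd`). [cite: MochizukiAbsTopIII2015, Prop 1.4 (i) p.31] -/
theorem not_forall_isFreeProcyclic :
    ¬ ∀ (G : Type) [Group G] [TopologicalSpace G],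
        Literature.AnabelianGeometry.AbsoluteAnabelian.FundamentalExtension.IsFreeProcyclic G := by
  intro h
  haveI : Subsingleton (Multiplicative (ZMod 1)) :=
    inferInstanceAs (Subsingleton (Multiplicative (Fin 1)))
  exact not_isFreeProcyclic_of_subsingleton (h (Multiplicative (ZMod 1)))

/-- … while the predicate IS satisfiable: Mathlib's profinite completion `Ẑ` of `ℤ` is free procyclic
(re-export of `isFreeProcyclic_zHatCompletion` in the `∃` form of the FACT-LIST model-witness column).
[cite: MochizukiAbsTopIII2015, Prop 1.4 (i) p.31] -/
theorem exists_isFreeProcyclic :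
    ∃ (G : Type) (_ : Group G) (_ : TopologicalSpace G),
      Literature.AnabelianGeometry.AbsoluteAnabelian.FundamentalExtension.IsFreeProcyclic G :=
  ⟨_, _, _, isFreeProcyclic_zHatCompletion⟩

end FundamentalExtension

end Literature.AnabelianGeometry.AbsoluteAnabelian
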